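import Literature.Probability.Percolation.QuadCrossingRawClosed
import Literature.Probability.Percolation.QuadCrossingQuadTopology
import Literature.Probability.Percolation.QuadCrossingPathCrossings
import Literature.Topology.PlaneTopology.PlusCrossing
import HarnessLib

/-!
# Stub S3a `stub_dualExclusion` of crux `Z2LimitsSymmetric` — lattice-level duality exclusion

Crux `Z2LimitsSymmetric` (stmt-CriticalPhenomena-14827) of route `CardyMeckeFlip`, sub-problem
`CardyFormulaZ2`, line `registered` (`Cruxes/Z2LimitsSymmetric/Lines/birth.lean`), stub S3a.

For a mesh `δ > 0`, a bond configuration `ω` on `ℤ²`, a quad `Q` and a transposed quad `Qt` (same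
carrier, `∂₀Qt = ∂₁Q`, `∂₂Qt = ∂₃Q`): if `Q` is crossed by the drawn open primal edges
(`Q ∈ S_ω = z2QuadConfig univ δ ω`), then `Qt` is NOT crossed by the true dual picture, namely the
Schramm–Smirnov configuration of the dual configuration `dualConfig ω` drawn on `δℤ²` and translated
by the half-mesh vector `v = (δ/2)(1 + i)` (dual vertex `u` = the face with lower-left corner `u`,
whose centre is `meshPoint δ u + v`).

Proof.  A crossing `K` of `Q` inside `openEdgeUnion δ ω` and a crossing `K'` of `Qt` inside
`v + openEdgeUnion δ (dualConfig ω)` are pulled back by the straightening chart `H` of `Q`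
(`Quad.exists_straighten`) to two continua of the square `[-1, 1]²`, one joining the vertical
edges, the other the horizontal ones; they meet (`inter_nonempty_of_crossing_continua`).  The
common point lies on a drawn open primal edge `[δx, δy]` and on a shifted drawn dual-open edge
`v + [δx', δy']`; rescaled to mesh `1` (`mem_segment_meshPoint_iff`) this is the tree's "a primal
edge and a planar dual edge meet only if they are dual to each other"
(`eq_dualEdge_of_mem_edgeTrace_inter`, `LatticePathArcs.lean`), so `s(x', y') = dualEdge s(x, y)`,
contradicting `mem_dualConfig_iff` (open dual edges cross closed primal edges).

## References

* [SchrammSmirnov2011] O. Schramm, S. Smirnov, Ann. Probab. 39 (2011) 1768–1814, §1.3.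
* [GrimmettPercolation1999] G. Grimmett, *Percolation*, 2nd ed. (1999), §11.2 (planar duality).
* [BollobasRiordan2006] B. Bollobás, O. Riordan, *Percolation* (2006), Ch. 7 Claim 19.
-/

noncomputable section

open Set
open Literature.Probability.LatticeModels
open Literature.Probability.Percolation Literature.Probability.Percolation.QuadCrossing

namespace Summit.CriticalPhenomena.CardyFormulaZ2.Cruxes.Z2LimitsSymmetric

/-! ### A shifted drawn dual edge meets only the primal edge it is dual to (mesh `δ`) -/

/-- **A shifted drawn dual edge meets only the primal edge it is dual to**, at mesh `δ > 0`: if a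
point `w` of the drawn primal lattice edge `[δx, δy]` is `v + w''` with `v = (δ/2)(1 + i)` and
`w''` on the drawn lattice edge `[δx', δy']`, then `{x', y'}` (read as a dual edge: dual vertex `u`
is the face with lower-left corner `u`) is the dual edge of `{x, y}`.  Rescaling by `δ⁻¹`
(`mem_segment_meshPoint_iff`) reduces this to the mesh-`1` statement
`eq_dualEdge_of_mem_edgeTrace_inter` of `LatticePathArcs.lean` (`dualOffset = (1 + i)/2`). -/
theorem dualEdge_eq_of_mem_segment {δ : ℝ} (hδ : 0 < δ) {x y x' y' : Site 2} {w w'' : ℂ}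
    (hxy : (zdGraph 2).Adj x y) (hx'y' : (zdGraph 2).Adj x' y')
    (hw : w ∈ segment ℝ (meshPoint δ x) (meshPoint δ y))
    (hw'' : w'' ∈ segment ℝ (meshPoint δ x') (meshPoint δ y'))
    (h : w = ((δ / 2 : ℝ) : ℂ) * (1 + Complex.I) + w'') :
    dualEdge s(x, y) = s(x', y') := by
  rw [mem_segment_meshPoint_iff hδ.ne'] at hw hw''
  refine (eq_dualEdge_of_mem_edgeTrace_inter ((zdGraph 2).mem_edgeSet.2 hxy)
    ((zdGraph 2).mem_edgeSet.2 hx'y') hw ⟨(δ : ℂ)⁻¹ * w'', hw'', ?_⟩).symm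
  show (δ : ℂ)⁻¹ * w'' + dualOffset = (δ : ℂ)⁻¹ * w
  have hδ' : (δ : ℂ) ≠ 0 := Complex.ofReal_ne_zero.2 hδ.ne'
  rw [h, dualOffset_eq]
  push_cast
  field_simp
  ring

/-! ### The stub -/

/-- **S3a `stub_dualExclusion`: lattice-level duality exclusion.**  For `δ > 0`, every bond
configuration `ω` on `ℤ²`, a quad `Q` and a transposed quad `Qt` (same carrier, `∂₀Qt = ∂₁Q`,
`∂₂Qt = ∂₃Q`): if `Q ∈ S_ω` (some compact connected subset of `[Q]` inside the drawn open primal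
edges joins `∂₀Q` to `∂₂Q`), then `Qt` is not crossed by the Schramm–Smirnov configuration of the
dual configuration `dualConfig ω` drawn on `δℤ²` and translated by the half-mesh vector
`(δ/2)(1 + i)`.  The two crossings would be pulled back by the straightening chart of `Q` to
crossing continua of `[-1, 1]²` in complementary directions, which meet; the meeting point lies on
a drawn open primal edge and on a shifted drawn open dual edge, and a shifted dual edge meets only
the primal edge it is dual to — which is then closed. -/
theorem stub_dualExclusion : open Literature.Probability.Percolation.QuadCrossing in ∀ (δ : ℝ), 0 < δ → ∀ (ω : Literature.Probability.Percolation.BondConfig (Literature.Probability.LatticeModels.Site 2)) (Q Qt : Quad (Set.univ : Set ℂ)), Qt.carrier = Q.carrier → Qt.side 0 = Q.side 1 → Qt.side 2 = Q.side 3 → Q ∈ Literature.Probability.Percolation.z2QuadConfig (Set.univ : Set ℂ) δ ω → Qt ∉ QuadConfig.translate (((δ / 2 : ℝ) : ℂ) * (1 + Complex.I)) (Literature.Probability.Percolation.z2QuadConfig (Set.univ : Set ℂ) δ (Literature.Probability.Percolation.dualConfig ω)) := by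
  intro δ hδ ω Q Qt hcar h01 h23 hQ hQt
  -- (1) an open primal crossing `K` of `Q`
  obtain ⟨K, ⟨hKc, hKconn, hKsub, hK0, hK2⟩, hKω⟩ :=
    (mem_z2QuadConfig_iff_exists_isCrossing hδ).mp hQ
  -- (1') a shifted dual-open crossing `v + K''` of `Qt`
  rw [QuadConfig.translate, QuadConfig.mem_mapHomeomorph,
    mem_z2QuadConfig_iff_exists_isCrossing hδ] at hQt
  obtain ⟨K'', hK'', hK''ω⟩ := hQt
  rw [Quad.isCrossing_mapHomeomorph_iff, Homeomorph.symm_symm] at hK''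
  obtain ⟨hLc, hLconn, hLsub, hL0, hL2⟩ := hK''
  -- (2) straighten `Q` and intersect the two continua in the chart
  obtain ⟨H, -, hcarH, hs0, hs1, hs2, hs3⟩ := Q.exists_straighten
  have hpre : ∀ {w : ℂ}, w ∈ Q.carrier → H.symm w ∈ Icc (-1 : ℝ) 1 ×ℂ Icc (-1 : ℝ) 1 := by
    intro w hw
    rw [hcarH] at hw
    obtain ⟨z, hz, rfl⟩ := hw
    rwa [Homeomorph.symm_apply_apply]
  have hside : ∀ {w : ℂ} {R : ℂ → Prop},
      w ∈ H '' {z | z ∈ Icc (-1 : ℝ) 1 ×ℂ Icc (-1 : ℝ) 1 ∧ R z} → R (H.symm w) := by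
    rintro w R ⟨z, ⟨-, hR⟩, rfl⟩
    rwa [Homeomorph.symm_apply_apply]
  obtain ⟨z, ⟨w, hwK, rfl⟩, ⟨w', hw'L, hww'⟩⟩ :=
    Literature.Topology.PlaneTopology.inter_nonempty_of_crossing_continua
      (K := H.symm '' K)
      (L := H.symm '' (Homeomorph.addLeft (((δ / 2 : ℝ) : ℂ) * (1 + Complex.I)) '' K''))
      (by norm_num : (-1 : ℝ) ≤ 1) (by norm_num : (-1 : ℝ) ≤ 1)
      (hKc.image H.symm.continuous)
      (hKconn.isPreconnected.image _ H.symm.continuous.continuousOn)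
      (fun _ ⟨w, hw, hzw⟩ => hzw ▸ hpre (hKsub hw))
      (by obtain ⟨w, hwK, hw0⟩ := hK0
          rw [hs0] at hw0
          exact ⟨H.symm w, mem_image_of_mem _ hwK, hside hw0⟩)
      (by obtain ⟨w, hwK, hw2⟩ := hK2
          rw [hs2] at hw2
          exact ⟨H.symm w, mem_image_of_mem _ hwK, hside hw2⟩)
      (hLc.image H.symm.continuous)
      (hLconn.isPreconnected.image _ H.symm.continuous.continuousOn)
      (fun _ ⟨w, hw, hzw⟩ => hzw ▸ hpre (by rw [← hcar]; exact hLsub hw))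
      (by obtain ⟨w, hwL, hw0⟩ := hL0
          rw [h01, hs1] at hw0
          exact ⟨H.symm w, mem_image_of_mem _ hwL, hside hw0⟩)
      (by obtain ⟨w, hwL, hw2⟩ := hL2
          rw [h23, hs3] at hw2
          exact ⟨H.symm w, mem_image_of_mem _ hwL, hside hw2⟩)
  obtain rfl : w' = w := H.symm.injective hww'
  -- (3) the common point lies on an open primal edge and on a shifted dual-open edge
  obtain ⟨w'', hw''K, hw''w⟩ := hw'L
  obtain ⟨x, y, hxy, hωxy, hwseg⟩ := mem_openEdgeUnion_iff.mp (hKω hwK)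
  obtain ⟨x', y', hx'y', hω', hw''seg⟩ := mem_openEdgeUnion_iff.mp (hK''ω hw''K)
  -- (4) the dual edge is the dual of the open primal edge: contradiction
  rw [mem_dualConfig_iff] at hω'
  exact hω'.2 _ hωxy (dualEdge_eq_of_mem_segment hδ hxy hx'y' hwseg hw''seg hw''w.symm)

end Summit.CriticalPhenomena.CardyFormulaZ2.Cruxes.Z2LimitsSymmetric

end
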